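import Literature.Analysis.Fourier.WeightedStationaryPhase
import HarnessLib

/-!
# RiemannHypothesis / LiPrimeEcho — crux K2 `LiPrimeEdgeEcho`, part 4: weighted sharp stationary phase with free ends (RH-FREE)

RH-FREE [rh-li-prover].  Route `Theses/LiPrimeEcho.lean` (rung «Li PRIME-ECHO LAW» `LiTheory.LiZeroWindowEcho`), item
`LiPrimeEdgeEcho` (stmt-RiemannHypothesis-19245).  The tree's `Literature.Analysis.Fourier.weightedStationaryPhase_sharp`
([Graham–Kolesnik 1991, Lemma 3.4], [Titchmarsh 1986, Lemma 4.6]) assumes an amplitude vanishing at both ends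
(`g(α) = g(β) = 0`), which it uses only to absorb the end-point terms `2/(r(c − α)) + 2/(r(β − c))` of
`stationaryPhase_log` into `G₁/r`.  The prime edge's amplitude `|F_n(1 − w)| Λ(2) 2^{−3/2}` does NOT vanish at the
window's ends, so we record the same theorem with those end-point terms kept (times `|g(c)|`):

  `‖∫_α^β g e^{iP} − g(c) 𝔣 e^{iP(c)} P''(c)^{−1/2}‖ ≤ |g(c)|·(2/(r(c−α)) + 2/(r(β−c)) + 2A³(λ₃/r²)(2 + L₁ + L₂))`
  `  + (G₁/r)(6 + (1 + A)(L₁ + L₂))`,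

convex (`r ≤ P'' ≤ Ar`) and concave (`r ≤ −P'' ≤ Ar`, constant `conj 𝔣`, `|P''(c)|^{−1/2}`) versions; the proof is the
tree's (split `g = g(c) + (g − g(c))`; `stationaryPhase_log` for the constant part, `norm_integral_amp_right/left_le`
for the defect).  Nothing here bears on the truth of RH.
-/

noncomputable section

-- D-0017: `Summit.<S>.<S>.…` is the designed namespace of a single-problem summit.
set_option linter.dupNamespace false

open MeasureTheory Set intervalIntegral Complex
open Literature.Analysis.Fourier

namespace Summit.RiemannHypothesis.RiemannHypothesis.Theorems.LiTheory

namespace PrimeEdge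

/-- **Weighted sharp stationary phase with free ends** (convex case): as `weightedStationaryPhase_sharp` but without
`g(α) = g(β) = 0`; the end-point terms `|g(c)|(2/(r(c − α)) + 2/(r(β − c)))` of `stationaryPhase_log` are kept.
[adapted from the tree's `Literature.Analysis.Fourier.weightedStationaryPhase_sharp`; Graham–Kolesnik 1991, Lemma 3.4] -/
theorem weightedStationaryPhase_free {P P' P'' P''' g g' : ℝ → ℝ} {α β c r A lam3 G₁ : ℝ}
    (hαc : α < c) (hcβ : c < β) (hr : 0 < r) (hA : 1 ≤ A)
    (hP : ∀ x ∈ Icc α β, HasDerivAt P (P' x) x) (hP' : ∀ x ∈ Icc α β, HasDerivAt P' (P'' x) x)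
    (hP'' : ∀ x ∈ Icc α β, HasDerivAt P'' (P''' x) x)
    (h2 : ∀ x ∈ Icc α β, r ≤ P'' x ∧ P'' x ≤ A * r) (h3 : ∀ x ∈ Icc α β, |P''' x| ≤ lam3) (hc : P' c = 0)
    (hg : ∀ x ∈ Icc α β, HasDerivAt g (g' x) x) (hg'c : ContinuousOn g' (Icc α β))
    (hG1 : ∀ x ∈ Icc α β, |g' x| ≤ G₁) :
    ‖(∫ x in α..β, (g x : ℂ) * Complex.exp (I * P x))
        - (g c : ℂ) * (fresnelC * Complex.exp (I * P c) * ((Real.sqrt (P'' c))⁻¹ : ℝ))‖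
      ≤ |g c| * (2 / (r * (c - α)) + 2 / (r * (β - c)) + 2 * A ^ 3 * (lam3 / r ^ 2) *
            (2 + Real.log (1 + (c - α) * Real.sqrt r) + Real.log (1 + (β - c) * Real.sqrt r)))
        + G₁ / r * (6 + (1 + A) * (Real.log (1 + (c - α) * Real.sqrt r) + Real.log (1 + (β - c) * Real.sqrt r))) := by
  -- adapted from reserve-free tree source `Literature/Analysis/Fourier/WeightedStationaryPhase.lean`
  have hαβ : α ≤ β := (hαc.trans hcβ).le
  have hcI : c ∈ Icc α β := ⟨hαc.le, hcβ.le⟩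
  have hG : 0 ≤ G₁ := (abs_nonneg _).trans (hG1 c hcI)
  set L₁ := Real.log (1 + (c - α) * Real.sqrt r) with hL₁
  set L₂ := Real.log (1 + (β - c) * Real.sqrt r) with hL₂
  set E : ℝ → ℂ := fun x => Complex.exp (I * P x) with hE
  have hEc : ContinuousOn E (Icc α β) := continuousOn_exp_I_mul hP
  have hgc : ContinuousOn g (Icc α β) := fun x hx => (hg x hx).continuousAt.continuousWithinAt
  have hP''c : ContinuousOn P'' (Icc α β) := fun x hx => (hP'' x hx).continuousAt.continuousWithinAt
  -- ### the main part `g(c) ∫ e^{iP}`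
  have hmain := stationaryPhase_log hαc hcβ hr hA hP hP' hP'' h2 h3 hc
  have hmain' : ‖(g c : ℂ) * ((∫ x in α..β, E x) - fresnelC * Complex.exp (I * P c) * ((Real.sqrt (P'' c))⁻¹ : ℝ))‖
      ≤ |g c| * (2 / (r * (c - α)) + 2 / (r * (β - c)) + 2 * A ^ 3 * (lam3 / r ^ 2) * (2 + L₁ + L₂)) := by
    rw [norm_mul, Complex.norm_real, Real.norm_eq_abs]
    exact mul_le_mul_of_nonneg_left hmain (abs_nonneg _)
  -- ### the defect part `∫ (g - g(c)) e^{iP}`, two sides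
  have hsubR : Icc c β ⊆ Icc α β := Icc_subset_Icc hαc.le le_rfl
  have hsubL : Icc α c ⊆ Icc α β := Icc_subset_Icc le_rfl hcβ.le
  have hk : ∀ x ∈ Icc α β, HasDerivAt (fun x => g x - g c) (g' x) x := fun x hx => (hg x hx).sub_const _
  have hB2 : ∀ x ∈ Icc α β, |P'' x| ≤ A * r := fun x hx => by
    rw [abs_of_pos (hr.trans_le (h2 x hx).1)]; exact (h2 x hx).2
  have hright : ‖∫ x in c..β, ((g x - g c : ℝ) : ℂ) * E x‖ ≤ G₁ / r * (3 + (1 + A * r / r) * L₂) :=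
    norm_integral_amp_right_le (k := fun x => g x - g c) hcβ.le hr (by positivity) hG
      (fun x hx => hP x (hsubR hx)) (fun x hx => hP' x (hsubR hx)) (hP''c.mono hsubR)
      (fun x hx => (deriv_bounds_right hP' (fun y hy => ⟨(h2 y hy).1, (h2 y hy).2⟩) hcI hc (hsubR hx) hx.1).1)
      (fun x hx => hB2 x (hsubR hx)) (fun x hx => hk x (hsubR hx)) (hg'c.mono hsubR)
      (fun x hx => hG1 x (hsubR hx)) (by simp)
  have hleft : ‖∫ x in α..c, ((g x - g c : ℝ) : ℂ) * E x‖ ≤ G₁ / r * (3 + (1 + A * r / r) * L₁) :=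
    norm_integral_amp_left_le (k := fun x => g x - g c) hαc.le hr (by positivity) hG
      (fun x hx => hP x (hsubL hx)) (fun x hx => hP' x (hsubL hx)) (hP''c.mono hsubL)
      (fun x hx => (deriv_bounds_left hP' (fun y hy => ⟨(h2 y hy).1, (h2 y hy).2⟩) hcI hc (hsubL hx) hx.2).1)
      (fun x hx => hB2 x (hsubL hx)) (fun x hx => hk x (hsubL hx)) (hg'c.mono hsubL)
      (fun x hx => hG1 x (hsubL hx)) (by simp)
  rw [mul_div_assoc, div_self hr.ne', mul_one] at hright hleft
  -- ### assembly
  have hi : ∀ p ∈ Icc α β, ∀ q ∈ Icc α β, IntervalIntegrable (fun x => ((g x - g c : ℝ) : ℂ) * E x) volume p q :=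
    fun p hp q hq => (((Complex.continuous_ofReal.comp_continuousOn (hgc.sub continuousOn_const)).mul hEc).mono
      (uIcc_subset_Icc hp hq)).intervalIntegrable
  have hiE : IntervalIntegrable E volume α β := (hEc.mono (by rw [uIcc_of_le hαβ])).intervalIntegrable
  have hsplit : (∫ x in α..β, (g x : ℂ) * E x)
      = (g c : ℂ) * (∫ x in α..β, E x) + ∫ x in α..β, ((g x - g c : ℝ) : ℂ) * E x := by
    rw [← intervalIntegral.integral_const_mul, ← intervalIntegral.integral_add (hiE.const_mul _)
      (hi α (left_mem_Icc.2 hαβ) β (right_mem_Icc.2 hαβ))]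
    refine intervalIntegral.integral_congr fun x _ => ?_
    push_cast; ring
  have hdef : ‖∫ x in α..β, ((g x - g c : ℝ) : ℂ) * E x‖ ≤ G₁ / r * (6 + (1 + A) * (L₁ + L₂)) := by
    rw [← intervalIntegral.integral_add_adjacent_intervals (hi α (left_mem_Icc.2 hαβ) c hcI)
      (hi c hcI β (right_mem_Icc.2 hαβ))]
    refine (norm_add_le _ _).trans ?_
    have : G₁ / r * (3 + (1 + A) * L₁) + G₁ / r * (3 + (1 + A) * L₂) = G₁ / r * (6 + (1 + A) * (L₁ + L₂)) := by ring
    linarith [hleft, hright]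
  calc ‖(∫ x in α..β, (g x : ℂ) * E x) - (g c : ℂ) * (fresnelC * Complex.exp (I * P c) * ((Real.sqrt (P'' c))⁻¹ : ℝ))‖
      = ‖(g c : ℂ) * ((∫ x in α..β, E x) - fresnelC * Complex.exp (I * P c) * ((Real.sqrt (P'' c))⁻¹ : ℝ))
          + ∫ x in α..β, ((g x - g c : ℝ) : ℂ) * E x‖ := by rw [hsplit]; congr 1; ring
    _ ≤ _ := (norm_add_le _ _).trans (add_le_add hmain' hdef)

/-- **Weighted sharp stationary phase with free ends, concave case** (`r ≤ −P'' ≤ Ar`; constant `conj 𝔣`,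
`|P''(c)|^{−1/2}`), by conjugation. [adapted from the tree's `weightedStationaryPhase_sharp_neg`] -/
theorem weightedStationaryPhase_free_neg {P P' P'' P''' g g' : ℝ → ℝ} {α β c r A lam3 G₁ : ℝ}
    (hαc : α < c) (hcβ : c < β) (hr : 0 < r) (hA : 1 ≤ A)
    (hP : ∀ x ∈ Icc α β, HasDerivAt P (P' x) x) (hP' : ∀ x ∈ Icc α β, HasDerivAt P' (P'' x) x)
    (hP'' : ∀ x ∈ Icc α β, HasDerivAt P'' (P''' x) x)
    (h2 : ∀ x ∈ Icc α β, r ≤ -P'' x ∧ -P'' x ≤ A * r) (h3 : ∀ x ∈ Icc α β, |P''' x| ≤ lam3) (hc : P' c = 0)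
    (hg : ∀ x ∈ Icc α β, HasDerivAt g (g' x) x) (hg'c : ContinuousOn g' (Icc α β))
    (hG1 : ∀ x ∈ Icc α β, |g' x| ≤ G₁) :
    ‖(∫ x in α..β, (g x : ℂ) * Complex.exp (I * P x))
        - (g c : ℂ) * ((starRingEnd ℂ) fresnelC * Complex.exp (I * P c) * ((Real.sqrt (-P'' c))⁻¹ : ℝ))‖
      ≤ |g c| * (2 / (r * (c - α)) + 2 / (r * (β - c)) + 2 * A ^ 3 * (lam3 / r ^ 2) *
            (2 + Real.log (1 + (c - α) * Real.sqrt r) + Real.log (1 + (β - c) * Real.sqrt r)))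
        + G₁ / r * (6 + (1 + A) * (Real.log (1 + (c - α) * Real.sqrt r) + Real.log (1 + (β - c) * Real.sqrt r))) := by
  have hab : α ≤ β := (hαc.trans hcβ).le
  have key := weightedStationaryPhase_free (P := fun x => -P x) (P' := fun x => -P' x) (P'' := fun x => -P'' x)
    (P''' := fun x => -P''' x) (g := g) (g' := g') hαc hcβ hr hA (fun x hx => (hP x hx).neg)
    (fun x hx => (hP' x hx).neg) (fun x hx => (hP'' x hx).neg) h2
    (fun x hx => by rw [abs_neg]; exact h3 x hx) (by simp [hc]) hg hg'c hG1
  have h1 : (starRingEnd ℂ) (∫ x in α..β, (g x : ℂ) * Complex.exp (I * ((-P x : ℝ) : ℂ)))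
      = ∫ x in α..β, (g x : ℂ) * Complex.exp (I * P x) := by
    rw [intervalIntegral.integral_of_le hab, intervalIntegral.integral_of_le hab, ← integral_conj]
    refine setIntegral_congr_fun measurableSet_Ioc fun x _ => ?_
    rw [map_mul, Complex.conj_ofReal, ← Complex.exp_conj, map_mul, Complex.conj_I, Complex.conj_ofReal]
    push_cast
    ring_nf
  have h2c : (starRingEnd ℂ) ((g c : ℂ) * (fresnelC * Complex.exp (I * ((-P c : ℝ) : ℂ))
        * (((Real.sqrt (-P'' c))⁻¹ : ℝ) : ℂ)))
      = (g c : ℂ) * ((starRingEnd ℂ) fresnelC * Complex.exp (I * P c) * ((Real.sqrt (-P'' c))⁻¹ : ℝ)) := by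
    rw [map_mul, map_mul, map_mul, Complex.conj_ofReal, Complex.conj_ofReal, ← Complex.exp_conj, map_mul,
      Complex.conj_I, Complex.conj_ofReal]
    push_cast
    ring_nf
  rw [← h1, ← h2c, ← map_sub, RCLike.norm_conj]
  exact key

end PrimeEdge

end Summit.RiemannHypothesis.RiemannHypothesis.Theorems.LiTheory
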